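import Summits.QuantumFields.YangMills.Theorems.SqueezedSkewnessChiChainRP
import Summits.QuantumFields.YangMills.Theorems.SqueezedSkewnessWeakFemtoUnit
import Summits.QuantumFields.YangMills.Theorems.SqueezedSkewnessQrpTranslateLogConvex
import HarnessLib

/-!
# Route `SqueezedSkewness`, LINE χ₄: `BalabanLadder.NT` (stmt-QuantumFields-19353) ⇐ `FemtoTwoPointUnit` ∧ `ShellSign` — kernel-checked

Fleet lead `ym-spine-19353-p1` g20 (capstone of the χ₄ «RP chessboard escalator» line of planner ym-idea-6 g12).  With the node-23719
stubs all LANDED by name — stub A `stub_qrpTranslateLogConvex` and stub 7 `stub_rpChordEscalator` (width seat ym-line-sfw-p2-w4 g19,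
`Theorems/SqueezedSkewnessQrpTranslateLogConvex.lean`), stub B `stub_escalatorOfLogConvex` (ym-line-sfw-p2-w5 g12,
`Theorems/SqueezedSkewnessEscalatorOfLogConvex.lean`) — and this seat's `CollarBumpFloors` / χ compositions
(`Theorems/SqueezedSkewnessChiChainRP.lean`, `…WeakFemtoUnit.lean`), the rung leaf of route `SqueezedSkewness` reduces BY NAME to exactly
TWO open items, with `TorusKL` (23204) off the path:

* `nt_of_femtoTwoPointUnit_shellSign : FemtoTwoPointUnit → ShellSign → BalabanLadder.NT` (items 23679, 27861);
* `nt_of_weakFemtoUnit_shellSign` — the same with `FemtoTwoPointUnit` weakened to a unit carrying `FBL6` and the weak floor clause (F)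
  (the consumption audit of `…WeakFemtoUnit`; no retype of 23679 is implied or requested).

HONEST FRAMING: pure composition of landed theorems; `FemtoTwoPointUnit` (the spine's femto two-point package, Bałaban-class, XL) and
`ShellSign` (lattice OPE sign, XL) are OPEN; no NT statement, rung of record or mass gap is proved; not Clay. [folklore]
-/

set_option autoImplicit false

namespace Summit.QuantumFields.YangMills.Theorems.SqueezedSkewnessChiChainFinal

open Filter Topology
open Literature.MathematicalPhysics.QuantumFieldTheory Literature.MathematicalPhysics.QuantumLattice
open Summit.QuantumFields.YangMills.Cruxes.OSLegsFromFemtoAndGap.DlrCollarTransfer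
open Summit.QuantumFields.YangMills.Theses.SqueezedSkewness

/-- **The χ₄ chain**: `FemtoTwoPointUnit → ShellSign → BalabanLadder.NT` — the RP chord escalator (stub 7, landed by name) discharges the
`TorusKL` input of LINE χ. [folklore] -/
theorem nt_of_femtoTwoPointUnit_shellSign (hU : FemtoTwoPointUnit) (hSign : ShellSign) :
    Summit.QuantumFields.YangMills.Theses.BalabanLadder.NT :=
  Summit.QuantumFields.YangMills.Theorems.SqueezedSkewnessChiChainRP.nt_of_femtoTwoPointUnit_rpEscalator_shellSign hU
    Summit.QuantumFields.YangMills.Theorems.SqueezedSkewnessEscalatorOfLogConvex.stub_rpChordEscalator hSign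

/-- **The χ₄ chain from the weak femto unit**: a unit carrying `FBL6` and the weak floor clause (F), together with `ShellSign`, gives
`BalabanLadder.NT` (via `femtoFloorUnit_of_weak`, the RP node composition and the route's `closes`). [folklore] -/
theorem nt_of_weakFemtoUnit_shellSign
    (h : ∀ (G : Type) [Group G] [TopologicalSpace G] [IsTopologicalGroup G] [CompactSpace G],
      IsCompactSimpleLieGroup G → letI : MeasurableSpace G := borel G; haveI : BorelSpace G := ⟨rfl⟩;
      ∃ (r : LatticeRep G) (a : ℝ → ℝ), (∀ β, 0 < a β) ∧ Tendsto a atTop (𝓝 0) ∧ FBL6 G r a ∧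
      (∃ (Γ : ℝ → ℝ) (β₂ ℓ₂ c₂ : ℝ) (K : ℝ → ℝ) (n₀ : ℕ), 0 < ℓ₂ ∧ 0 < c₂ ∧ (∀ s, 1 ≤ K s) ∧
      Tendsto (fun s : ℝ => s * K s) (nhdsWithin 0 (Set.Ioi 0)) (nhds 0) ∧ 1 ≤ n₀ ∧
      Tendsto (fun s : ℝ => Γ s / s ^ 8) (nhdsWithin 0 (Set.Ioi 0)) atTop ∧
      ∀ β : ℝ, β₂ ≤ β → ∀ (x : Fin 4 → ℤ) (R : ℕ), ((2 * R + 1 : ℕ) : ℝ) * a β ≤ ℓ₂ →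
        ∀ (η : LGConfig 4 G) (y : Fin 4 → ℤ) (s₀ : ℝ), 0 < s₀ → s₀ ≤ ‖siteToE (y - x)‖ * a β →
          (n₀ : ℝ) ≤ ‖siteToE (y - x)‖ → ‖siteToE (y - x)‖ < 3 * siteToE (y - x) 0 →
            K s₀ * ‖siteToE (y - x)‖ ≤ depth (fun j => x j - R) (2 * R + 1) y →
              c₂ * Γ (‖siteToE (y - x)‖ * a β) ≤
                ‖siteToE (y - x)‖ ^ 8 * kerCov G r β (fun j => x j - R) (2 * R + 1) η (dens G r x) (dens G r y)))
    (hSign : ShellSign) : Summit.QuantumFields.YangMills.Theses.BalabanLadder.NT :=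
  closes
    (Summit.QuantumFields.YangMills.Theorems.SqueezedSkewnessChiChainRP.pointlikeHypercubeFloorsB_of_rpEscalator
      (Summit.QuantumFields.YangMills.Theorems.SqueezedSkewnessWeakFemtoUnit.femtoFloorUnit_of_weak h)
      Summit.QuantumFields.YangMills.Theorems.SqueezedSkewnessEscalatorOfLogConvex.stub_rpChordEscalator)
    Summit.QuantumFields.YangMills.Theorems.squeezedSkewness_seamFromMoments_proof
    Summit.QuantumFields.YangMills.Theorems.squeezedSkewness_hypercubeSeam
    Summit.QuantumFields.YangMills.Theorems.squeezedSkewness_shellGeometry hSign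

end Summit.QuantumFields.YangMills.Theorems.SqueezedSkewnessChiChainFinal
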